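import Literature.NumberTheory.Sieve.DrappeauDispersionLemmas
import Literature.NumberTheory.Sieve.FouvryTenenbaumDivisorAPTuple
import Literature.NumberTheory.Sieve.CharacterSumAPPeriodBound
import HarnessLib

/-!
# Drappeau's kernel `𝔲_R` against smooth variables, I: the kernel identity and the character part

Topic `Literature/NumberTheory/Sieve`; theorems only (plus the bookkeeping definition `aRep`), everything
PROVED.  This is the first file of the treatment of the Type I (`τ_ℓ`-like) sums in S. Drappeau, *Sums of
Kloosterman sums in arithmetic progressions, and the error term in the dispersion method*, PLMS 114 (2017) §6.2
(arXiv:1504.05549, p. 22: the trichotomy's third case, all small variables of product `< x^η` and `ℓ ≤ 3` smooth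
variables `> x^{1/3−η}`), for the conductor-truncated kernel `𝔲_R` of §5 (5.1):

`𝔲_R(ν n c̄; s) = g_s(n; c ν̄) − φ(s)⁻¹ ∑_{ψ ≠ ψ₀, cond ψ ≤ R} ψ(ν c̄) ψ(n)`   (`uR_natCast_mul_eq`)

(Fouvry–Tenenbaum's weight `g_s(n; a) = 1_{n ≡ a (s)} − 1_{(n,s)=1}/φ(s)`, `FouvryTenenbaum2021.gAP`), and the
bound for the subtracted characters against smooth variables in unit classes `mod L`, `(L, s) = 1`: they contribute
`≤ #(initial tuples) · τ(s) · cond ψ` each (period bound on the last variable,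
`CharacterAP.norm_sum_Icc_filter_char_le`; `norm_charPart_le`), uniformly in a hyperbolic window; the
ranges of the variables are Fouvry–Tenenbaum's `apBox lo hi L t = {⌊lo⌋ < m ≤ ⌊hi⌋ : m ≡ t (L)}`.

* `aRep`, `aRep_cast`, `isCoprime_aRep` — the class `c ν̄ (mod s)` as an integer;
* `uR_natCast_mul_eq` — the identity above; `uR_eq_zero_of_not_isUnit`;
* `card_smallConductor_le` — `#{ψ ≠ ψ₀ : cond ψ ≤ R} ≤ R τ(s)`;
* `filter_Ioc_eq_Ioc_of_antitone` — a downward-closed cut of an interval is an interval;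
* `norm_charPart_le`, `norm_charPart_total_le` — the character part (one `ψ`; all `ψ ≠ ψ₀` of conductor `≤ R`).

## References

* S. Drappeau, Proc. London Math. Soc. (3) 114 (2017) 684–732, §5 (5.1)–(5.2), §6.2. [Drappeau2017]
* É. Fouvry, G. Tenenbaum, Trans. Amer. Math. Soc. 375 (2022), §1.1 (the weight `g_q`). [FouvryTenenbaum2021]
-/

open Finset Fintype Real
open scoped ArithmeticFunction.sigma Classical

noncomputable section

namespace Literature.NumberTheory.Sieve

namespace DrappeauTypeI

open Drappeau2017 FouvryTenenbaum2021

/-! ### The kernel against one residue: `𝔲_R = g_s − (small-conductor characters)` -/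

/-- The representative `a ∈ [0, s)` of `c ν̄ (mod s)`. [folklore] -/
def aRep (s : ℕ) (c : ℤ) (ν : ℕ) : ℤ :=
  (((c : ZMod s) * ((ν : ZMod s))⁻¹).val : ℤ)

/-- `aRep` reduces to `c ν̄`. [folklore] -/
theorem aRep_cast {s : ℕ} [NeZero s] (c : ℤ) (ν : ℕ) :
    ((aRep s c ν : ℤ) : ZMod s) = (c : ZMod s) * ((ν : ZMod s))⁻¹ := by
  rw [aRep, Int.cast_natCast, ZMod.natCast_zmod_val]

/-- Inverses of units of `ZMod n` are units. [folklore] -/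
theorem isUnit_inv_of_isUnit {n : ℕ} {a : ZMod n} (h : IsUnit a) : IsUnit a⁻¹ :=
  isUnit_iff_exists.2 ⟨a, ZMod.inv_mul_of_unit a h, ZMod.mul_inv_of_unit a h⟩

/-- `(s, aRep) = 1` when `c` and `ν` are units `mod s`. [folklore] -/
theorem isCoprime_aRep {s : ℕ} [NeZero s] {c : ℤ} {ν : ℕ} (hc : IsCoprime (s : ℤ) c) (hν : ν.Coprime s) :
    IsCoprime (s : ℤ) (aRep s c ν) := by
  rw [← ZMod.coe_int_isUnit_iff_isCoprime, aRep_cast]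
  exact ((ZMod.coe_int_isUnit_iff_isCoprime c s).2 hc).mul
    (isUnit_inv_of_isUnit ((ZMod.isUnit_iff_coprime ν s).2 hν))

/-- The small-conductor part of `mainKernel` with the principal character split off:
`∑_{cond ψ ≤ R} ψ(t) = 1_{t unit} + ∑_{ψ ≠ ψ₀, cond ψ ≤ R} ψ(t)` for `R ≥ 1`. [cite: Drappeau2017, §5 (5.1)] -/
theorem mainKernel_eq_principal_add {s : ℕ} [NeZero s] {R : ℝ} (hR : 1 ≤ R) (t : ZMod s) :
    mainKernel R s t = ((Nat.totient s : ℂ))⁻¹ *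
      ((if IsUnit t then 1 else 0) +
        ∑ ψ ∈ (univ : Finset (DirichletCharacter ℂ s)).filter (fun ψ => ψ ≠ 1 ∧ (ψ.conductor : ℝ) ≤ R),
          ψ t) := by
  unfold mainKernel
  congr 1
  rw [← Finset.sum_filter, ← Finset.sum_erase_add _ _ (a := (1 : DirichletCharacter ℂ s))]
  · rw [add_comm]
    congr 1
    · by_cases hu : IsUnit t
      · rw [MulChar.one_apply hu, if_pos hu]
      · rw [MulChar.map_nonunit _ hu, if_neg hu]
    · refine Finset.sum_congr ?_ fun _ _ => rfl
      ext ψ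
      simp only [Finset.mem_erase, Finset.mem_filter, Finset.mem_univ, true_and]
  · exact Finset.mem_filter.2 ⟨Finset.mem_univ _, by
      rw [DirichletCharacter.conductor_one]; exact_mod_cast hR⟩

/-- **`𝔲_R(ν n c̄; s) = g_s(n; c ν̄) − φ(s)⁻¹ ∑_{ψ ≠ ψ₀, cond ψ ≤ R} ψ(ν c̄) ψ(n)`** for `s ≥ 1`, `R ≥ 1`,
`(s, cν) = 1` and every `n` (Drappeau (5.1): `𝔲_R(t) = 1_{t = 1} − φ⁻¹ ∑_{cond ψ ≤ R} ψ(t)`, the principal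
character having conductor `1 ≤ R`; for `(n, s) > 1` both sides vanish termwise). [cite: Drappeau2017, §5 (5.1)] -/
theorem uR_natCast_mul_eq {s : ℕ} [NeZero s] {R : ℝ} (hR : 1 ≤ R) {c : ℤ} {ν : ℕ}
    (hc : IsCoprime (s : ℤ) c) (hν : ν.Coprime s) (n : ℕ) :
    uR R s (((ν * n : ℕ) : ZMod s) * ((c : ZMod s))⁻¹) =
      (gAP s (aRep s c ν) n : ℂ) -
        ((Nat.totient s : ℂ))⁻¹ *
          ∑ ψ ∈ (univ : Finset (DirichletCharacter ℂ s)).filter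
              (fun ψ => ψ ≠ 1 ∧ (ψ.conductor : ℝ) ≤ R),
            ψ ((ν : ZMod s) * ((c : ZMod s))⁻¹) * ψ (n : ZMod s) := by
  have hcu : IsUnit (c : ZMod s) := (ZMod.coe_int_isUnit_iff_isCoprime c s).2 hc
  have hνu : IsUnit (ν : ZMod s) := (ZMod.isUnit_iff_coprime ν s).2 hν
  have hcinv : IsUnit ((c : ZMod s))⁻¹ := isUnit_inv_of_isUnit hcu
  set t : ZMod s := ((ν * n : ℕ) : ZMod s) * ((c : ZMod s))⁻¹ with ht
  have htn : t = ((ν : ZMod s) * ((c : ZMod s))⁻¹) * (n : ZMod s) := by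
    rw [ht]; push_cast; ring
  -- `uR = 1_{t=1} − mainKernel`
  have h1 := mainKernel_add_uR_eq_ite R t
  have huR : uR R s t = (if t = 1 then 1 else 0) - mainKernel R s t := by rw [← h1]; ring
  rw [huR, mainKernel_eq_principal_add hR t]
  -- identify the two indicator functions with `gAP`
  have hind1 : (t = 1) ↔ ((n : ZMod s) = ((aRep s c ν : ℤ) : ZMod s)) := by
    rw [aRep_cast, htn]
    constructor
    · intro h
      calc (n : ZMod s) = ((c : ZMod s) * ((ν : ZMod s))⁻¹) *
            (((ν : ZMod s) * ((c : ZMod s))⁻¹) * (n : ZMod s)) := by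
              calc (n : ZMod s) = ((c : ZMod s) * ((c : ZMod s))⁻¹) * (((ν : ZMod s))⁻¹ * (ν : ZMod s)) *
                    (n : ZMod s) := by
                      rw [ZMod.mul_inv_of_unit _ hcu, ZMod.inv_mul_of_unit _ hνu]; ring
                _ = _ := by ring
        _ = (c : ZMod s) * ((ν : ZMod s))⁻¹ := by rw [h, mul_one]
    · intro h
      rw [h]
      calc (ν : ZMod s) * ((c : ZMod s))⁻¹ * ((c : ZMod s) * ((ν : ZMod s))⁻¹)
          = ((c : ZMod s) * ((c : ZMod s))⁻¹) * ((ν : ZMod s) * ((ν : ZMod s))⁻¹) := by ring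
        _ = 1 := by rw [ZMod.mul_inv_of_unit _ hcu, ZMod.mul_inv_of_unit _ hνu, mul_one]
  have hind2 : IsUnit t ↔ n.Coprime s := by
    rw [← ZMod.isUnit_iff_coprime, htn]
    constructor
    · intro h
      exact isUnit_of_mul_isUnit_right h
    · intro h
      exact (hνu.mul hcinv).mul h
  have hgAP : (gAP s (aRep s c ν) n : ℂ) =
      (if t = 1 then (1 : ℂ) else 0) - ((Nat.totient s : ℂ))⁻¹ * (if IsUnit t then 1 else 0) := by
    unfold gAP
    by_cases h1 : t = 1
    · have h2 : IsUnit t := h1 ▸ isUnit_one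
      rw [if_pos h1, if_pos h2, if_pos (hind1.1 h1), if_pos (hind2.1 h2)]
      push_cast; ring
    · by_cases h2 : IsUnit t
      · rw [if_neg h1, if_pos h2, if_neg (fun h => h1 (hind1.2 h)), if_pos (hind2.1 h2)]
        push_cast; ring
      · rw [if_neg h1, if_neg h2, if_neg (fun h => h1 (hind1.2 h)), if_neg (fun h => h2 (hind2.2 h))]
        push_cast; ring
  rw [hgAP, mul_add]
  have hterms : ∑ ψ ∈ (univ : Finset (DirichletCharacter ℂ s)).filter (fun ψ => ψ ≠ 1 ∧ (ψ.conductor : ℝ) ≤ R),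
      ψ t = ∑ ψ ∈ (univ : Finset (DirichletCharacter ℂ s)).filter (fun ψ => ψ ≠ 1 ∧ (ψ.conductor : ℝ) ≤ R),
        ψ ((ν : ZMod s) * ((c : ZMod s))⁻¹) * ψ (n : ZMod s) := by
    refine Finset.sum_congr rfl fun ψ _ => ?_
    rw [htn, map_mul]
  rw [hterms]
  ring

/-- `𝔲_R(t; s) = 0` for non-units `t`. [cite: Drappeau2017, §5 (5.1)] -/
theorem uR_eq_zero_of_not_isUnit (R : ℝ) (s : ℕ) {t : ZMod s} (ht : ¬ IsUnit t) : uR R s t = 0 := by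
  unfold uR
  rw [Finset.sum_eq_zero fun χ _ => ?_, mul_zero]
  rw [MulChar.map_nonunit _ ht]
  split_ifs <;> rfl

/-- The number of characters `mod s` of conductor `≤ R` other than `ψ₀` is `≤ R τ(s)`. [cite: Drappeau2017, §5 (5.2)] -/
theorem card_smallConductor_le {s : ℕ} (hs : 0 < s) {R : ℝ} (hR : 0 ≤ R) :
    (((univ : Finset (DirichletCharacter ℂ s)).filter (fun ψ => ψ ≠ 1 ∧ (ψ.conductor : ℝ) ≤ R)).card : ℝ) ≤
      R * (σ 0 s : ℝ) := by
  have h := DrappeauTopacogullari2019.card_filter_conductor_le hs hR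
  rw [ArithmeticFunction.sigma_zero_apply]
  refine le_trans ?_ h
  exact_mod_cast Finset.card_le_card (fun ψ hψ => by
    rw [Finset.mem_filter] at hψ ⊢; exact ⟨hψ.1, hψ.2.2⟩)

/-! ### The character part: period bound on the last variable -/

/-- A downward-closed condition cuts an interval `(A₀, B₀]` to an interval `(A₀, B₁]`. [folklore] -/
theorem filter_Ioc_eq_Ioc_of_antitone (W : ℕ → Prop) [DecidablePred W]
    (hW : ∀ m n, m ≤ n → W n → W m) (A₀ B₀ : ℕ) :
    ∃ B₁, (Ioc A₀ B₀).filter W = Ioc A₀ B₁ := by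
  rcases ((Ioc A₀ B₀).filter W).eq_empty_or_nonempty with h | h
  · refine ⟨A₀, ?_⟩
    rw [h, Finset.Ioc_self]
  · obtain ⟨b, hb, hbmax⟩ := ((Ioc A₀ B₀).filter W).exists_max_image id h
    refine ⟨b, ?_⟩
    rw [Finset.mem_filter, Finset.mem_Ioc] at hb
    ext n
    simp only [Finset.mem_filter, Finset.mem_Ioc]
    constructor
    · rintro ⟨⟨h1, h2⟩, h3⟩
      exact ⟨h1, hbmax n (by rw [Finset.mem_filter, Finset.mem_Ioc]; exact ⟨⟨h1, h2⟩, h3⟩)⟩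
    · rintro ⟨h1, h2⟩
      exact ⟨⟨h1, h2.trans hb.1.2⟩, hW n b h2 hb.2⟩

/-- The period bound on a sub-interval `(A₀, B₁]` in a progression. [cite: Drappeau2017, §6.2] -/
theorem norm_sum_Ioc_filter_char_le {s : ℕ} [NeZero s] {ψ : DirichletCharacter ℂ s} (hψ : ψ ≠ 1) {L : ℕ}
    (hL : 0 < L) (hLs : L.Coprime s) (tl : ℤ) (A₀ B₁ : ℕ) :
    ‖∑ n ∈ (Ioc A₀ B₁).filter (fun n : ℕ => (n : ZMod L) = (tl : ZMod L)), ψ (n : ZMod s)‖ ≤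
      (σ 0 s : ℝ) * ψ.conductor := by
  rw [← Finset.Icc_add_one_left_eq_Ioc]
  exact CharacterAP.norm_sum_Icc_filter_char_le hψ hL hLs _ _ _

/-- **The small-conductor characters against smooth variables.**  For `ψ mod s`, `ψ ≠ ψ₀`, `(L, s) = 1`, initial
tuples `m⃗` in any finite set `B` and the last variable in a progression `mod L` inside an interval, cut by the
hyperbola `ν (∏ mᵢ) n ≤ Y`: `|∑_{m⃗ ∈ B} ∑_{n} ψ((∏mᵢ) n)| ≤ #B · τ(s) · cond ψ`. [cite: Drappeau2017, §6.2] -/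
theorem norm_charPart_le {s : ℕ} [NeZero s] {ψ : DirichletCharacter ℂ s} (hψ : ψ ≠ 1) {L : ℕ} (hL : 0 < L)
    (hLs : L.Coprime s) {k : ℕ} (B : Finset (Fin k → ℕ)) (lo hi : ℝ) (tl : ℤ) (ν : ℕ) (Y : ℝ) :
    ‖∑ m ∈ B, ∑ n ∈ apBox lo hi L tl,
        (if ((ν * ((∏ i, m i) * n) : ℕ) : ℝ) ≤ Y then ψ (((∏ i, m i) * n : ℕ) : ZMod s) else 0)‖ ≤
      (B.card : ℝ) * ((σ 0 s : ℝ) * ψ.conductor) := by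
  unfold apBox
  generalize ⌊lo⌋₊ = A₀
  generalize ⌊hi⌋₊ = B₀
  have hkey : ∀ m ∈ B, ‖∑ n ∈ (Ioc A₀ B₀).filter (fun n : ℕ => (n : ZMod L) = (tl : ZMod L)),
      (if ((ν * ((∏ i, m i) * n) : ℕ) : ℝ) ≤ Y then ψ (((∏ i, m i) * n : ℕ) : ZMod s) else 0)‖ ≤
        (σ 0 s : ℝ) * ψ.conductor := by
    intro m _
    set P : ℕ := ∏ i, m i with hP
    set W : ℕ → Prop := fun n => ((ν * (P * n) : ℕ) : ℝ) ≤ Y with hWdef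
    have hW : ∀ a b, a ≤ b → W b → W a := by
      intro a b hab hb
      simp only [hWdef] at hb ⊢
      refine le_trans ?_ hb
      exact_mod_cast Nat.mul_le_mul_left _ (Nat.mul_le_mul_left _ hab)
    obtain ⟨B₁, hB₁⟩ := filter_Ioc_eq_Ioc_of_antitone W hW A₀ B₀
    -- pull the window into the range of summation
    have hrw : ∑ n ∈ (Ioc A₀ B₀).filter (fun n : ℕ => (n : ZMod L) = (tl : ZMod L)),
        (if ((ν * (P * n) : ℕ) : ℝ) ≤ Y then ψ (((P * n : ℕ)) : ZMod s) else 0) =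
        ψ (P : ZMod s) * ∑ n ∈ (Ioc A₀ B₁).filter (fun n : ℕ => (n : ZMod L) = (tl : ZMod L)),
          ψ (n : ZMod s) := by
      rw [← hB₁, Finset.filter_filter, Finset.mul_sum, ← Finset.sum_filter, Finset.filter_filter]
      have hset : (Ioc A₀ B₀).filter (fun n : ℕ => (n : ZMod L) = (tl : ZMod L) ∧ ((ν * (P * n) : ℕ) : ℝ) ≤ Y) =
          (Ioc A₀ B₀).filter (fun n : ℕ => W n ∧ (n : ZMod L) = (tl : ZMod L)) :=
        Finset.filter_congr fun n _ => by simp only [hWdef]; tauto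
      rw [hset]
      refine Finset.sum_congr rfl fun n _ => ?_
      rw [Nat.cast_mul, map_mul]
    rw [hrw, norm_mul]
    calc ‖ψ (P : ZMod s)‖ * ‖∑ n ∈ (Ioc A₀ B₁).filter (fun n : ℕ => (n : ZMod L) = (tl : ZMod L)),
          ψ (n : ZMod s)‖ ≤ 1 * ((σ 0 s : ℝ) * ψ.conductor) :=
          mul_le_mul (ψ.norm_le_one _) (norm_sum_Ioc_filter_char_le hψ hL hLs tl A₀ B₁)
            (norm_nonneg _) zero_le_one
      _ = _ := one_mul _
  calc _ ≤ ∑ m ∈ B, ‖∑ n ∈ (Ioc A₀ B₀).filter (fun n : ℕ => (n : ZMod L) = (tl : ZMod L)),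
          (if ((ν * ((∏ i, m i) * n) : ℕ) : ℝ) ≤ Y then ψ (((∏ i, m i) * n : ℕ) : ZMod s) else 0)‖ :=
        norm_sum_le _ _
    _ ≤ ∑ m ∈ B, (σ 0 s : ℝ) * ψ.conductor := Finset.sum_le_sum hkey
    _ = _ := by rw [Finset.sum_const, nsmul_eq_mul]

/-- **The whole character part for one modulus**: summing `norm_charPart_le` over the `≤ R τ(s)` characters
`ψ ≠ ψ₀` of conductor `≤ R`, with the weights `|ψ(a)| ≤ 1` and the factor `φ(s)⁻¹`:
`φ(s)⁻¹ ‖∑_{ψ} ψ(a) ∑_{m⃗, n} [window] ψ((∏mᵢ)n)‖ ≤ R² #B τ(s)²/φ(s)`. [cite: Drappeau2017, §6.2] -/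
theorem norm_charPart_total_le {s : ℕ} [NeZero s] {L : ℕ} (hL : 0 < L) (hLs : L.Coprime s) {k : ℕ}
    (B : Finset (Fin k → ℕ)) (lo hi : ℝ) (tl : ℤ) (ν : ℕ) (Y : ℝ) {R : ℝ} (hR : 0 ≤ R) (a : ZMod s) :
    (Nat.totient s : ℝ)⁻¹ *
      ‖∑ ψ ∈ (univ : Finset (DirichletCharacter ℂ s)).filter (fun ψ => ψ ≠ 1 ∧ (ψ.conductor : ℝ) ≤ R),
        ψ a * ∑ m ∈ B, ∑ n ∈ apBox lo hi L tl,
          (if ((ν * ((∏ i, m i) * n) : ℕ) : ℝ) ≤ Y then ψ (((∏ i, m i) * n : ℕ) : ZMod s) else 0)‖ ≤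
      R ^ 2 * (B.card : ℝ) * ((σ 0 s : ℝ) ^ 2 / (Nat.totient s : ℝ)) := by
  have hs0 : 0 < s := Nat.pos_of_ne_zero (NeZero.ne s)
  have hφ : (0 : ℝ) < Nat.totient s := by exact_mod_cast Nat.totient_pos.2 hs0
  have hχ : ∀ ψ ∈ (univ : Finset (DirichletCharacter ℂ s)).filter (fun ψ => ψ ≠ 1 ∧ (ψ.conductor : ℝ) ≤ R),
      ‖ψ a * ∑ m ∈ B, ∑ n ∈ apBox lo hi L tl,
      (if ((ν * ((∏ i, m i) * n) : ℕ) : ℝ) ≤ Y then ψ (((∏ i, m i) * n : ℕ) : ZMod s) else 0)‖ ≤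
        (B.card : ℝ) * ((σ 0 s : ℝ) * R) := by
    intro ψ hψ
    rw [Finset.mem_filter] at hψ
    rw [norm_mul]
    refine (mul_le_mul (ψ.norm_le_one _) ((norm_charPart_le hψ.2.1 hL hLs B lo hi tl ν Y).trans ?_)
      (norm_nonneg _) zero_le_one).trans (le_of_eq (one_mul _))
    have : (σ 0 s : ℝ) * ψ.conductor ≤ (σ 0 s : ℝ) * R := mul_le_mul_of_nonneg_left hψ.2.2 (Nat.cast_nonneg _)
    exact mul_le_mul_of_nonneg_left this (Nat.cast_nonneg _)
  have hcard : ((((univ : Finset (DirichletCharacter ℂ s)).filter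
      (fun ψ => ψ ≠ 1 ∧ (ψ.conductor : ℝ) ≤ R)).card : ℕ) : ℝ) ≤ R * (σ 0 s : ℝ) := by
    convert card_smallConductor_le (s := s) hs0 hR using 4
  have hsum := (norm_sum_le _ _).trans (Finset.sum_le_sum hχ)
  rw [Finset.sum_const, nsmul_eq_mul] at hsum
  refine (mul_le_mul_of_nonneg_left hsum (inv_nonneg.2 hφ.le)).trans ?_
  have hB : (0 : ℝ) ≤ (B.card : ℝ) * ((σ 0 s : ℝ) * R) := by positivity
  calc (Nat.totient s : ℝ)⁻¹ *
        (((((univ : Finset (DirichletCharacter ℂ s)).filter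
            (fun ψ => ψ ≠ 1 ∧ (ψ.conductor : ℝ) ≤ R)).card : ℕ) : ℝ) * ((B.card : ℝ) * ((σ 0 s : ℝ) * R)))
      ≤ (Nat.totient s : ℝ)⁻¹ * ((R * (σ 0 s : ℝ)) * ((B.card : ℝ) * ((σ 0 s : ℝ) * R))) :=
        mul_le_mul_of_nonneg_left (mul_le_mul_of_nonneg_right hcard hB) (inv_nonneg.2 hφ.le)
    _ = R ^ 2 * (B.card : ℝ) * ((σ 0 s : ℝ) ^ 2 / (Nat.totient s : ℝ)) := by
        rw [div_eq_mul_inv]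
        ring

end DrappeauTypeI

end Literature.NumberTheory.Sieve

end
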